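import Summits.Ventures.YMGap.RobustBall.LoopActionFiniteRange
import Summits.Ventures.YMGap.RobustBall.MassGapOnBallMassiveRows
import Summits.Ventures.YMGap.RobustBall.MassGapOnBallS
import HarnessLib

/-!
# Venture YMGap, track ROBUST-BALL (tier 1) — FINITE-RANGE loop actions are MASSIVE theories: every DLR state of
# every generic Wilson-type loop action of bounded extent inside a tier-1 row is an Osterwalder–Seiler massive state

HONEST FRAMING. WHAT THIS IS: a venture file (cell `pub-ymgap`, track Y2 ROBUST-BALL, seat ds-3): the massive
reading of rb-p1's `LoopActionFiniteRange.lean`. There, a generic Wilson-type loop action `loopFamilyAction N γ c`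
whose loops have `ℓ^∞`-extent `≤ R`, with finite carrier fibres and finitely many loops through every link, and
UNWEIGHTED norm `‖c‖₀ ≤ ε` (`LoopNormLE 0 γ c ε`: `∑_{i : e ∈ γ_i} |c_i| |γ_i| ≤ ε` through every link) is a member of
rb-p1's TIER-1 ball `MemBallZd (2ε) ε R` with support family `loopSupp γ` (`memBallZd_loopFamilyAction`). Composing with
the seat's conversion `massive_of_perturbedMassGapAt` (`MassGapOnBallMassiveRows.lean`) gives, for every TIER-1 row
`MassGapOnBallZd 4 N β (2ε) ε R`: DLR states exist and EVERY DLR state is an Osterwalder–Seiler MASSIVE STATE with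
exponentially decaying plaquette–plaquette correlation function (`massive_loopFamilyAction_of_tier1`; stated in the
tier-2 currency `perturbedGibbsMeasuresS`, which for supported potentials is the tier-1 one, `perturbedYMS_eq_perturbedYM`).
CELLS (`SU(2)`, `d = 4`, twice the coupling of the weighted cells): `β_W = 1/8` for `‖c‖₀ ≤ 0.143`
(`su2_loopFamilyFR_massive_1_8`), `1/10` for `0.209`, `3/20` for `0.085`, `1/6` for `0.049`; every `N ≥ 2` at 't Hooft
`|β| ≤ 1/64` for `‖c‖₀ ≤ 0.11` (`suN_loopFamilyFR_massive_1_64`); ALL closed trails of length `≤ L₀`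
(`su2_trailsLE_massive_1_8`, `suN_trailsLE_massive_1_64`). WHAT IT IS NOT: no new radius; strong-coupling lattice
statements; nothing about the continuum limit or the Clay Millennium problem.

References: rb-p1 `LoopActionFiniteRange.lean`, `RowsSU2.lean`, `RowsSUNCells.lean`; ds-3 `MassGapOnBallMassiveRows.lean`,
`LoopActionMassive.lean`; K. Osterwalder, E. Seiler, Ann. Phys. 110 (1978) 440, §4.
-/

noncomputable section

open MeasureTheory ProbabilityTheory Function Finset Filter Topology
open scoped NNReal
open Literature.Probability.LatticeModels
open Literature.MathematicalPhysics.QuantumLattice hiding torusNorm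
open Literature.MathematicalPhysics.QuantumFieldTheory hiding ZdEdge Site
open Literature.Barriers.QuantumFields (IsMassiveState)

namespace Summit.Ventures.YMGap.RobustBall

variable {N : ℕ} {ι : Type*}

/-! ### Schema: a tier-1 row makes every finite-range loop action a massive theory -/

/-- **Finite-range loop actions are MASSIVE theories on every tier-1 row** (`d = 4`, `N ≥ 1`): if
`MassGapOnBallZd 4 N β (2ε) ε R` and the loop family has finite carrier fibres, finitely many loops through every link,
loops of `ℓ^∞`-extent `≤ R` and `‖c‖₀ ≤ ε`, then `SU(N)` Wilson at 't Hooft `β` plus `loopFamilyAction N γ c` has DLR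
states on `ℤ⁴`, and EVERY DLR state is an Osterwalder–Seiler massive state with plaquette–plaquette decay. [folklore] -/
theorem massive_loopFamilyAction_of_tier1 (hN : 1 ≤ N) {β ε R : ℝ} (hrow : MassGapOnBallZd 4 N β (2 * ε) ε R)
    {γ : ι → ZdLoop 4} {c : ι → ℝ} (hfin : ∀ X, {i | walkEdges (γ i).walk = X}.Finite)
    (hthr : ∀ e : ZdEdge 4, {i | e ∈ walkEdges (γ i).walk}.Finite)
    (hR : ∀ i, ∀ e ∈ walkEdges (γ i).walk, ∀ y ∈ walkEdges (γ i).walk, ‖e.1 - y.1‖ ≤ R) (h : LoopNormLE 0 γ c ε) :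
    (perturbedGibbsMeasuresS (d := 4) (fundamentalRep (Fin N)) ((N : ℝ) * β)
        (loopFamilyAction (d := 4) N γ c)).Nonempty ∧
      ∀ μ ∈ perturbedGibbsMeasuresS (d := 4) (fundamentalRep (Fin N)) ((N : ℝ) * β) (loopFamilyAction (d := 4) N γ c),
        IsMassiveState μ ∧ HasExponentialDecay (plaquetteCorrFn (fundamentalRep (Fin N)) μ) := by
  have hmem := memBallZd_loopFamilyAction (N := N) hfin hthr hR h
  have key := massive_of_perturbedMassGapAt hN hmem (hrow _ _ hmem)
  have e : perturbedGibbsMeasuresS (d := 4) (fundamentalRep (Fin N)) ((N : ℝ) * β) (loopFamilyAction (d := 4) N γ c) =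
      perturbedGibbsMeasures (d := 4) (fundamentalRep (Fin N)) ((N : ℝ) * β) (loopFamilyAction (d := 4) N γ c)
        (loopSupp γ) := by
    unfold perturbedGibbsMeasuresS perturbedGibbsMeasures
    rw [perturbedYMS_eq_perturbedYM _ _ hmem.supportedBy]
  rw [e]
  exact key

/-! ### Cells (`d = 4`) -/

section Rows

variable {γ : ι → ZdLoop 4} {c : ι → ℝ} {R : ℝ}

/-- ★ **`SU(2)`, `ℤ⁴`, `β_W = 1/8`: every finite-range loop action with `‖c‖₀ ≤ 0.143` is a MASSIVE theory** — DLR states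
exist and every DLR state is massive with plaquette–plaquette decay (tier-1 row `su2_rowB_1_8`; rb-p1's clustering cell
`su2_loopFamilyFR_massGapS_1_8`). [folklore] -/
theorem su2_loopFamilyFR_massive_1_8 (hfin : ∀ X, {i | walkEdges (γ i).walk = X}.Finite)
    (hthr : ∀ e : ZdEdge 4, {i | e ∈ walkEdges (γ i).walk}.Finite)
    (hR : ∀ i, ∀ e ∈ walkEdges (γ i).walk, ∀ y ∈ walkEdges (γ i).walk, ‖e.1 - y.1‖ ≤ R)
    (h : LoopNormLE 0 γ c (143 / 1000)) :
    (perturbedGibbsMeasuresS (d := 4) (fundamentalRep (Fin 2)) (((2 : ℕ) : ℝ) * ((1 / 8 : ℝ) / 4))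
        (loopFamilyAction (d := 4) 2 γ c)).Nonempty ∧
      ∀ μ ∈ perturbedGibbsMeasuresS (d := 4) (fundamentalRep (Fin 2)) (((2 : ℕ) : ℝ) * ((1 / 8 : ℝ) / 4))
          (loopFamilyAction (d := 4) 2 γ c),
        IsMassiveState μ ∧ HasExponentialDecay (plaquetteCorrFn (fundamentalRep (Fin 2)) μ) :=
  massive_loopFamilyAction_of_tier1 (by norm_num) (su2_rowB_1_8 R) hfin hthr hR h

/-- **`SU(2)`, `ℤ⁴`, `β_W = 1/10`**: finite-range loop actions with `‖c‖₀ ≤ 0.209` are massive theories (row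
`su2_rowB_1_10`). [folklore] -/
theorem su2_loopFamilyFR_massive_1_10 (hfin : ∀ X, {i | walkEdges (γ i).walk = X}.Finite)
    (hthr : ∀ e : ZdEdge 4, {i | e ∈ walkEdges (γ i).walk}.Finite)
    (hR : ∀ i, ∀ e ∈ walkEdges (γ i).walk, ∀ y ∈ walkEdges (γ i).walk, ‖e.1 - y.1‖ ≤ R)
    (h : LoopNormLE 0 γ c (209 / 1000)) :
    (perturbedGibbsMeasuresS (d := 4) (fundamentalRep (Fin 2)) (((2 : ℕ) : ℝ) * ((1 / 10 : ℝ) / 4))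
        (loopFamilyAction (d := 4) 2 γ c)).Nonempty ∧
      ∀ μ ∈ perturbedGibbsMeasuresS (d := 4) (fundamentalRep (Fin 2)) (((2 : ℕ) : ℝ) * ((1 / 10 : ℝ) / 4))
          (loopFamilyAction (d := 4) 2 γ c),
        IsMassiveState μ ∧ HasExponentialDecay (plaquetteCorrFn (fundamentalRep (Fin 2)) μ) :=
  massive_loopFamilyAction_of_tier1 (by norm_num) (su2_rowB_1_10 R) hfin hthr hR h

/-- **`SU(2)`, `ℤ⁴`, `β_W = 3/20`**: finite-range loop actions with `‖c‖₀ ≤ 0.085` are massive theories (row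
`su2_rowB_3_20`). [folklore] -/
theorem su2_loopFamilyFR_massive_3_20 (hfin : ∀ X, {i | walkEdges (γ i).walk = X}.Finite)
    (hthr : ∀ e : ZdEdge 4, {i | e ∈ walkEdges (γ i).walk}.Finite)
    (hR : ∀ i, ∀ e ∈ walkEdges (γ i).walk, ∀ y ∈ walkEdges (γ i).walk, ‖e.1 - y.1‖ ≤ R)
    (h : LoopNormLE 0 γ c (17 / 200)) :
    (perturbedGibbsMeasuresS (d := 4) (fundamentalRep (Fin 2)) (((2 : ℕ) : ℝ) * ((3 / 20 : ℝ) / 4))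
        (loopFamilyAction (d := 4) 2 γ c)).Nonempty ∧
      ∀ μ ∈ perturbedGibbsMeasuresS (d := 4) (fundamentalRep (Fin 2)) (((2 : ℕ) : ℝ) * ((3 / 20 : ℝ) / 4))
          (loopFamilyAction (d := 4) 2 γ c),
        IsMassiveState μ ∧ HasExponentialDecay (plaquetteCorrFn (fundamentalRep (Fin 2)) μ) :=
  massive_loopFamilyAction_of_tier1 (by norm_num) (su2_rowB_3_20 R) hfin hthr hR h

/-- **`SU(2)`, `ℤ⁴`, `β_W = 1/6`** (the lineage-B door's edge): finite-range loop actions with `‖c‖₀ ≤ 0.049` are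
massive theories (row `su2_rowB_1_6`). [folklore] -/
theorem su2_loopFamilyFR_massive_1_6 (hfin : ∀ X, {i | walkEdges (γ i).walk = X}.Finite)
    (hthr : ∀ e : ZdEdge 4, {i | e ∈ walkEdges (γ i).walk}.Finite)
    (hR : ∀ i, ∀ e ∈ walkEdges (γ i).walk, ∀ y ∈ walkEdges (γ i).walk, ‖e.1 - y.1‖ ≤ R)
    (h : LoopNormLE 0 γ c (49 / 1000)) :
    (perturbedGibbsMeasuresS (d := 4) (fundamentalRep (Fin 2)) (((2 : ℕ) : ℝ) * ((1 / 6 : ℝ) / 4))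
        (loopFamilyAction (d := 4) 2 γ c)).Nonempty ∧
      ∀ μ ∈ perturbedGibbsMeasuresS (d := 4) (fundamentalRep (Fin 2)) (((2 : ℕ) : ℝ) * ((1 / 6 : ℝ) / 4))
          (loopFamilyAction (d := 4) 2 γ c),
        IsMassiveState μ ∧ HasExponentialDecay (plaquetteCorrFn (fundamentalRep (Fin 2)) μ) :=
  massive_loopFamilyAction_of_tier1 (by norm_num) (su2_rowB_1_6 R) hfin hthr hR h

/-- ★ **Every `N ≥ 2`, `ℤ⁴`, 't Hooft `|β| ≤ 1/64`, HYPOTHESIS-FREE**: finite-range loop actions with `‖c‖₀ ≤ 0.11` are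
massive theories, `N`-uniformly (p1's tier-1 cell `suN_zdRow4_1_64`). [folklore] -/
theorem suN_loopFamilyFR_massive_1_64 (hN : 2 ≤ N) {β : ℝ} (hβ : |β| ≤ 1 / 64) {γ : ι → ZdLoop 4} {c : ι → ℝ}
    (hfin : ∀ X, {i | walkEdges (γ i).walk = X}.Finite) (hthr : ∀ e : ZdEdge 4, {i | e ∈ walkEdges (γ i).walk}.Finite)
    (hR : ∀ i, ∀ e ∈ walkEdges (γ i).walk, ∀ y ∈ walkEdges (γ i).walk, ‖e.1 - y.1‖ ≤ R)
    (h : LoopNormLE 0 γ c (11 / 100)) :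
    (perturbedGibbsMeasuresS (d := 4) (fundamentalRep (Fin N)) ((N : ℝ) * β)
        (loopFamilyAction (d := 4) N γ c)).Nonempty ∧
      ∀ μ ∈ perturbedGibbsMeasuresS (d := 4) (fundamentalRep (Fin N)) ((N : ℝ) * β) (loopFamilyAction (d := 4) N γ c),
        IsMassiveState μ ∧ HasExponentialDecay (plaquetteCorrFn (fundamentalRep (Fin N)) μ) := by
  have hrow := RobustBallSUN.suN_zdRow4_1_64 hN hβ R
  have hrow' : MassGapOnBallZd 4 N β (2 * (11 / 100)) (11 / 100) R := by norm_num at hrow ⊢; exact hrow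
  exact massive_loopFamilyAction_of_tier1 (by omega) hrow' hfin hthr hR h

end Rows

/-! ### All closed trails of bounded length -/

/-- ★ **`SU(2)`, `ℤ⁴`, `β_W = 1/8` — ALL closed trails of length `≤ L₀` at once**: every coupling function with
`∑_{γ ∋ e} |c_γ| |γ| ≤ 0.143` through every link gives a MASSIVE theory (tier-1 row at range `2L₀`; rb-p1's
`su2_trailsLE_massGapS_1_8`). [folklore] -/
theorem su2_trailsLE_massive_1_8 (L₀ : ℕ) {c : TrailIdxLE 4 L₀ → ℝ} (h : LoopNormLE 0 (trailLoopLE L₀) c (143 / 1000)) :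
    (perturbedGibbsMeasuresS (d := 4) (fundamentalRep (Fin 2)) (((2 : ℕ) : ℝ) * ((1 / 8 : ℝ) / 4))
        (loopFamilyAction (d := 4) 2 (trailLoopLE L₀) c)).Nonempty ∧
      ∀ μ ∈ perturbedGibbsMeasuresS (d := 4) (fundamentalRep (Fin 2)) (((2 : ℕ) : ℝ) * ((1 / 8 : ℝ) / 4))
          (loopFamilyAction (d := 4) 2 (trailLoopLE L₀) c),
        IsMassiveState μ ∧ HasExponentialDecay (plaquetteCorrFn (fundamentalRep (Fin 2)) μ) :=
  su2_loopFamilyFR_massive_1_8 finite_fibre_trailLoopLE finite_through_trailLoopLE norm_sub_le_trailLoopLE h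

/-- **Every `N ≥ 2`, `ℤ⁴`, 't Hooft `|β| ≤ 1/64` — all closed trails of length `≤ L₀`**: `‖c‖₀ ≤ 0.11` gives a massive
theory (rb-p1's `suN_trailsLE_massGapS_1_64`). [folklore] -/
theorem suN_trailsLE_massive_1_64 (hN : 2 ≤ N) {β : ℝ} (hβ : |β| ≤ 1 / 64) (L₀ : ℕ) {c : TrailIdxLE 4 L₀ → ℝ}
    (h : LoopNormLE 0 (trailLoopLE L₀) c (11 / 100)) :
    (perturbedGibbsMeasuresS (d := 4) (fundamentalRep (Fin N)) ((N : ℝ) * β)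
        (loopFamilyAction (d := 4) N (trailLoopLE L₀) c)).Nonempty ∧
      ∀ μ ∈ perturbedGibbsMeasuresS (d := 4) (fundamentalRep (Fin N)) ((N : ℝ) * β)
          (loopFamilyAction (d := 4) N (trailLoopLE L₀) c),
        IsMassiveState μ ∧ HasExponentialDecay (plaquetteCorrFn (fundamentalRep (Fin N)) μ) :=
  suN_loopFamilyFR_massive_1_64 hN hβ finite_fibre_trailLoopLE finite_through_trailLoopLE norm_sub_le_trailLoopLE h

end Summit.Ventures.YMGap.RobustBall

end
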